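import Summits.AtomisticToContinuum.BoseEinsteinCondensation.Theses.BECStronglyRayleigh
import Summits.AtomisticToContinuum.BoseEinsteinCondensation.Theorems.BECStronglyRayleighInsertionFieldDelocalisationTranslationInvariance
import Summits.AtomisticToContinuum.BoseEinsteinCondensation.Theorems.BECStronglyRayleighSectorGroundStatePerron
import Summits.AtomisticToContinuum.BoseEinsteinCondensation.Theorems.InsertionFieldDelocalisation.Negative.Toolkit
import Summits.AtomisticToContinuum.BoseEinsteinCondensation.Theorems.InsertionFieldDelocalisation.Negative.PerronExistence
import Summits.AtomisticToContinuum.BoseEinsteinCondensation.Theorems.InsertionFieldDelocalisation.Negative.Tightness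
import Literature.MathematicalPhysics.QuantumLattice.LiebMattisLadder
import Literature.MathematicalPhysics.QuantumLattice.LiebMattisMatrixElements
import Literature.MathematicalPhysics.QuantumLattice.LiebMattisSectorPF
import HarnessLib

/-!
# Helpers for stub `stub_insertionInfidelityLow` (Stub A-low of line `Sketch`, crux `KineticLatticeBEC`,
# stmt-AtomisticToContinuum-9671): occupation-basis bookkeeping for `Ŝ⁺_tot` and flat one-particle data

Hard-core bosons on a finite set `Λ` = spin `½` (occupied = up = index `0`, occupation indicators
`1_S = fun z => if z ∈ S then 0 else 1`).  This file supplies the elementary finite bookkeeping used by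
the dilute rungs `N = 0, 1` of the insertion-fidelity bound:

* `iil_star_dotProduct_real`: the pairing of entrywise real vectors is `Σ Re u · Re v`;
* `iil_raise_apply`, `iil_raise_apply_ind`, `iil_raise_flat`: `Ŝ⁺_tot = totalSpin 1 0 + I • totalSpin 1 1`
  adds one boson, `(Ŝ⁺ψ)(1_S) = Σ_{x ∈ S} ψ(1_{S ∖ x})` (`LiebMattis.raise_mulVec_apply`), so a vector flat
  on the `n`-sets is mapped to `(n+1)`× the flat vector on the `(n+1)`-sets;
* `iil_sum_config`, `iil_sum_card_ite`, `iil_sum_eq_sum_powersetCard`, `iil_sum_pairs`: sums over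
  configurations are sums over occupied sets, and the double counting `Σ_x Σ_{y ≠ x} φ{x,y} = 2 Σ_{|S|=2} φ S`;
* `iil_apply_ind_eq_zero`: sector-`N` vectors live on the `N`-set indicators;
* `iil_translationInvariance` (all `N ≤ L³`, the proof of the landed `stub_translationInvariance`, which
  never used `2 ≤ N`) and `iil_one_flat`: an admissible one-particle datum of `xyTorus 3 L 1` is the
  constant `ψ(1_{{0}})` on singletons.
-/

noncomputable section

namespace Summit.AtomisticToContinuum.BoseEinsteinCondensation.Cruxes.KineticLatticeBEC.SectorLadder

open scoped BigOperators Matrix ComplexOrder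
open Literature.MathematicalPhysics.QuantumLattice Literature.Probability.LatticeModels Matrix Complex Finset
open Summit.AtomisticToContinuum.BoseEinsteinCondensation.Theses.BECStronglyRayleigh
open Summit.AtomisticToContinuum.BoseEinsteinCondensation.Theorems.InsertionFieldDelocalisation.Negative
open Summit.AtomisticToContinuum.BoseEinsteinCondensation.Cruxes.InsertionFieldDelocalisation.LogInsertionInfraredBound
  (g4ti_mulVec_translate g4ti_mem_spinZSector_translate)


/-! ### Generic bookkeeping: real entries, the action of `Ŝ⁺_tot`, sums over configurations -/

/-- The pairing of two entrywise real vectors is the real number `Σ_i Re u_i · Re v_i`. [folklore] -/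
theorem iil_star_dotProduct_real {ι : Type*} [Fintype ι] (u v : ι → ℂ)
    (hu : ∀ i, (u i).im = 0) (hv : ∀ i, (v i).im = 0) :
    star u ⬝ᵥ v = ((∑ i, (u i).re * (v i).re : ℝ) : ℂ) := by
  rw [dotProduct, Complex.ofReal_sum]
  refine Finset.sum_congr rfl fun i _ => ?_
  apply Complex.ext
  · simp [Complex.mul_re, hu i, hv i]
  · simp [Complex.mul_im, hu i, hv i]

/-- **`Ŝ⁺_tot` for spin `½` adds one boson**: `(Ŝ⁺ψ)(σ) = Σ_{x : σ_x = 0} ψ(σ[x ↦ 1])`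
(occupied = up = index `0`). [folklore] -/
theorem iil_raise_apply {Λ : Type*} [Fintype Λ] [DecidableEq Λ] (ψ : TensorIndex Λ 2 → ℂ)
    (σ : TensorIndex Λ 2) :
    ((totalSpin 1 0 + I • totalSpin 1 1 : Op Λ 2) *ᵥ ψ) σ =
      ∑ x, if σ x = 0 then ψ (Function.update σ x 1) else 0 := by
  rw [LiebMattis.raise_mulVec_apply]
  refine Finset.sum_congr rfl fun x _ => ?_
  rw [Fin.sum_univ_two, spinRaise_apply, spinRaise_apply]
  generalize σ x = k
  fin_cases k <;> simp

/-- `Ŝ⁺_tot` preserves entrywise real vectors. [folklore] -/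
theorem iil_raise_im {Λ : Type*} [Fintype Λ] [DecidableEq Λ] (ψ : TensorIndex Λ 2 → ℂ)
    (hψ : ∀ σ, (ψ σ).im = 0) (σ : TensorIndex Λ 2) :
    (((totalSpin 1 0 + I • totalSpin 1 1 : Op Λ 2) *ᵥ ψ) σ).im = 0 := by
  rw [iil_raise_apply, Complex.im_sum]
  refine Finset.sum_eq_zero fun x _ => ?_
  split_ifs
  · exact hψ _
  · exact Complex.zero_im

/-- Emptying the site `x` of the occupation indicator `1_S` gives `1_{S ∖ x}`. [folklore] -/
theorem iil_update_ind {Λ : Type*} [DecidableEq Λ] (S : Finset Λ) (x : Λ) :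
    Function.update (fun z => if z ∈ S then (0 : Fin 2) else 1) x 1 =
      fun z => if z ∈ S.erase x then (0 : Fin 2) else 1 := by
  funext z
  by_cases hz : z = x
  · subst hz
    simp [Finset.mem_erase]
  · simp [Finset.mem_erase, hz]

/-- **`Ŝ⁺_tot` in the occupation basis**: `(Ŝ⁺ψ)(1_S) = Σ_{x ∈ S} ψ(1_{S ∖ x})`. [folklore] -/
theorem iil_raise_apply_ind {Λ : Type*} [Fintype Λ] [DecidableEq Λ] (ψ : TensorIndex Λ 2 → ℂ)
    (S : Finset Λ) :
    ((totalSpin 1 0 + I • totalSpin 1 1 : Op Λ 2) *ᵥ ψ) (fun z => if z ∈ S then 0 else 1) =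
      ∑ x ∈ S, ψ (fun z => if z ∈ S.erase x then 0 else 1) := by
  rw [iil_raise_apply]
  have h : ∀ x, (if (if x ∈ S then (0 : Fin 2) else 1) = 0 then
      ψ (Function.update (fun z => if z ∈ S then (0 : Fin 2) else 1) x 1) else 0) =
      if x ∈ S then ψ (fun z => if z ∈ S.erase x then 0 else 1) else 0 := by
    intro x
    rw [iil_update_ind]
    by_cases hx : x ∈ S <;> simp [hx]
  rw [Finset.sum_congr rfl fun x _ => h x, Finset.sum_ite_mem, Finset.univ_inter]

/-- **`Ŝ⁺_tot` of a flat `n`-particle vector is the flat `(n+1)`-particle vector**: if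
`ψ(1_S) = c·[|S| = n]` then `(Ŝ⁺ψ)(1_S) = (n+1)c·[|S| = n+1]`. [folklore] -/
theorem iil_raise_flat {Λ : Type*} [Fintype Λ] [DecidableEq Λ] (ψ : TensorIndex Λ 2 → ℂ) (n : ℕ)
    (c : ℂ) (hψ : ∀ S : Finset Λ, ψ (fun z => if z ∈ S then 0 else 1) = if S.card = n then c else 0)
    (S : Finset Λ) :
    ((totalSpin 1 0 + I • totalSpin 1 1 : Op Λ 2) *ᵥ ψ) (fun z => if z ∈ S then 0 else 1) =
      if S.card = n + 1 then ((n + 1 : ℕ) : ℂ) * c else 0 := by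
  rw [iil_raise_apply_ind]
  have h : ∀ x ∈ S, ψ (fun z => if z ∈ S.erase x then 0 else 1) =
      if S.card = n + 1 then c else 0 := by
    intro x hx
    rw [hψ, Finset.card_erase_of_mem hx]
    have h1 : 1 ≤ S.card := Finset.card_pos.2 ⟨x, hx⟩
    by_cases hS : S.card = n + 1
    · rw [if_pos hS, if_pos (by omega)]
    · rw [if_neg hS, if_neg (by omega)]
  rw [Finset.sum_congr rfl h, Finset.sum_const, nsmul_eq_mul]
  by_cases hS : S.card = n + 1
  · rw [if_pos hS, if_pos hS, hS]
  · rw [if_neg hS, if_neg hS, mul_zero]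

/-- **Configurations are occupation indicators**: `Σ_σ F(σ) = Σ_{S ⊆ Λ} F(1_S)`. [folklore] -/
theorem iil_sum_config {Λ : Type*} [Fintype Λ] [DecidableEq Λ] {M : Type*} [AddCommMonoid M]
    (F : TensorIndex Λ 2 → M) :
    ∑ σ, F σ = ∑ S : Finset Λ, F (fun z => if z ∈ S then 0 else 1) := by
  refine (Fintype.sum_bijective (fun S : Finset Λ => fun z => if z ∈ S then (0 : Fin 2) else 1)
    ⟨fun S S' h => (ind_eq_ind_iff S S').1 h,
      fun σ => ⟨univ.filter (fun x => σ x = 0), ind_filter_eq σ⟩⟩ _ _ (fun _ => rfl)).symm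

/-- `Σ_S c·[|S| = n] = C(|Λ|, n)·c`. [folklore] -/
theorem iil_sum_card_ite {Λ : Type*} [Fintype Λ] (n : ℕ) (c : ℝ) :
    ∑ S : Finset Λ, (if S.card = n then c else 0) = ((Fintype.card Λ).choose n : ℝ) * c := by
  rw [← Finset.sum_filter, Finset.univ_filter_card_eq, Finset.sum_const, Finset.card_powersetCard,
    Finset.card_univ, nsmul_eq_mul]

/-- A function of finite sets supported on `n`-sets sums over the `n`-sets. [folklore] -/
theorem iil_sum_eq_sum_powersetCard {Λ : Type*} [Fintype Λ] (f : Finset Λ → ℝ) (n : ℕ)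
    (hf : ∀ S, S.card ≠ n → f S = 0) :
    ∑ S : Finset Λ, f S = ∑ S ∈ (univ : Finset Λ).powersetCard n, f S := by
  refine (Finset.sum_subset (Finset.subset_univ _) fun S _ hS => hf S ?_).symm
  rwa [Finset.mem_powersetCard_univ] at hS

/-- **Double counting of pairs**: `Σ_x Σ_{y ≠ x} φ{x,y} = 2 Σ_{|S| = 2} φ(S)`. [folklore] -/
theorem iil_sum_pairs {Λ : Type*} [Fintype Λ] [DecidableEq Λ] (φ : Finset Λ → ℝ) :
    ∑ x : Λ, ∑ y : Λ, (if x = y then 0 else φ {x, y}) =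
      2 * ∑ S ∈ (univ : Finset Λ).powersetCard 2, φ S := by
  have h1 : 2 * ∑ S ∈ (univ : Finset Λ).powersetCard 2, φ S =
      ∑ S ∈ (univ : Finset Λ).powersetCard 2, ∑ x, if x ∈ S then φ S else 0 := by
    rw [Finset.mul_sum]
    refine Finset.sum_congr rfl fun S hS => ?_
    rw [Finset.sum_ite_mem, Finset.univ_inter, Finset.sum_const, (Finset.mem_powersetCard.1 hS).2,
      nsmul_eq_mul, Nat.cast_two]
  rw [h1, Finset.sum_comm (s := (univ : Finset Λ).powersetCard 2)]
  refine Finset.sum_congr rfl fun x _ => ?_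
  have eL : ∑ y ∈ (univ : Finset Λ).filter (fun y => x ≠ y), φ {x, y} =
      ∑ y : Λ, (if x = y then 0 else φ {x, y}) := by
    rw [Finset.sum_filter]
    refine Finset.sum_congr rfl fun y _ => ?_
    by_cases h : x = y
    · rw [if_neg (not_not.2 h), if_pos h]
    · rw [if_pos h, if_neg h]
  have eR : ∑ S ∈ ((univ : Finset Λ).powersetCard 2).filter (fun S => x ∈ S), φ S =
      ∑ S ∈ (univ : Finset Λ).powersetCard 2, if x ∈ S then φ S else 0 := Finset.sum_filter _ _
  rw [← eL, ← eR]
  refine Finset.sum_nbij (fun y => ({x, y} : Finset Λ)) ?_ ?_ ?_ (fun _ _ => rfl)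
  · intro y hy
    have hxy : x ≠ y := (Finset.mem_filter.1 hy).2
    exact Finset.mem_filter.2 ⟨Finset.mem_powersetCard.2 ⟨Finset.subset_univ _, Finset.card_pair hxy⟩,
      Finset.mem_insert_self _ _⟩
  · intro y hy y' _ h
    have hxy : x ≠ y := (Finset.mem_filter.1 (Finset.mem_coe.1 hy)).2
    have h' : ({x, y} : Finset Λ) = {x, y'} := h
    have hmem : y ∈ ({x, y'} : Finset Λ) := by
      rw [← h']
      exact Finset.mem_insert_of_mem (Finset.mem_singleton_self y)
    rw [Finset.mem_insert, Finset.mem_singleton] at hmem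
    rcases hmem with rfl | rfl
    · exact absurd rfl hxy
    · rfl
  · intro S hS
    have hS' := Finset.mem_filter.1 (Finset.mem_coe.1 hS)
    obtain ⟨u, v, huv, rfl⟩ := Finset.card_eq_two.1 (Finset.mem_powersetCard.1 hS'.1).2
    have hx := hS'.2
    rw [Finset.mem_insert, Finset.mem_singleton] at hx
    rcases hx with rfl | rfl
    · exact ⟨v, by simp [huv], rfl⟩
    · exact ⟨u, by simp [Ne.symm huv], Finset.pair_comm _ _⟩

/-- **Sector support**: a vector of the sector `S³ = N - |Λ|/2` vanishes on `1_S` unless `|S| = N`.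
[folklore] -/
theorem iil_apply_ind_eq_zero {Λ : Type*} [Fintype Λ] [DecidableEq Λ] (ψ : TensorIndex Λ 2 → ℂ)
    (N : ℕ) (Msec : ℝ) (hMsec : Msec = (N : ℝ) - (Fintype.card Λ : ℝ) / 2)
    (hsec : ψ ∈ spinZSector 1 Msec) (S : Finset Λ) (hS : S.card ≠ N) :
    ψ (fun z => if z ∈ S then 0 else 1) = 0 := by
  by_contra hne
  have hmag := (LiebMattis.mem_spinZSector_iff 1 Msec ψ).mp hsec _ hne
  rw [magnetisation_ind, hMsec] at hmag
  push_cast at hmag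
  have h : (S.card : ℂ) = (N : ℂ) := by linear_combination hmag
  exact hS (by exact_mod_cast h)

/-! ### The three-torus: translation invariance and flat one-particle data -/

/-- `|(ℤ/Lℤ)³| = L³` over `ℝ`. [folklore] -/
theorem iil_card_real (L : ℕ) [NeZero L] : (Fintype.card (TorusSite 3 L) : ℝ) = (L : ℝ) ^ 3 := by
  rw [Summit.AtomisticToContinuum.BoseEinsteinCondensation.Theorems.InsertionFieldDelocalisation.Negative.card_torusSite]
  push_cast
  ring

/-- **Admissible data are translation invariant** (all `N ≤ L³`; the landed `stub_translationInvariance`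
is the case `2 ≤ N`, same proof): Hamiltonian covariance, Perron uniqueness
(`SectorGroundStatePerron_proof`) and conservation of the (nonzero) entry sum pin the scalar to `1`.
[folklore] -/
theorem iil_translationInvariance (L : ℕ) [NeZero L] (hL : 2 ≤ L) (N : ℕ) (hN3 : N ≤ L ^ 3)
    (ψ : TensorIndex (TorusSite 3 L) 2 → ℂ)
    (hψK : ψ ∈ spinZSector 1 ((N : ℝ) - (L : ℝ) ^ 3 / 2)) (hψ0 : ψ ≠ 0)
    (hHψ : (xyTorus 3 L 1).mulVec ψ =
      ((lowestEnergyInSector 1 (xyTorus 3 L 1) ((N : ℝ) - (L : ℝ) ^ 3 / 2) : ℝ) : ℂ) • ψ)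
    (hψnn : ∀ σ, 0 ≤ (ψ σ).re ∧ (ψ σ).im = 0)
    (a : TorusSite 3 L) (σ : TensorIndex (TorusSite 3 L) 2) : ψ (fun x => σ (x + a)) = ψ σ := by
  -- adapted from `stub_translationInvariance`
  -- (Theorems/BECStronglyRayleighInsertionFieldDelocalisationTranslationInvariance.lean)
  set φ : TensorIndex (TorusSite 3 L) 2 → ℂ := fun σ => ψ (σ ∘ Equiv.addRight a) with hφdef
  have hHφ : (xyTorus 3 L 1).mulVec φ =
      ((lowestEnergyInSector 1 (xyTorus 3 L 1) ((N : ℝ) - (L : ℝ) ^ 3 / 2) : ℝ) : ℂ) • φ :=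
    g4ti_mulVec_translate L 1 a _ ψ hHψ
  have hφK : φ ∈ spinZSector 1 ((N : ℝ) - (L : ℝ) ^ 3 / 2) :=
    g4ti_mem_spinZSector_translate L 1 a _ ψ hψK
  obtain ⟨ψ₀, -, -, -, -, huniq⟩ :=
    Summit.AtomisticToContinuum.BoseEinsteinCondensation.Theorems.SectorGroundStatePerron_proof
      3 L (by norm_num) hL N hN3
  obtain ⟨c₁, hc₁⟩ := huniq ψ hψK hHψ
  obtain ⟨c₂, hc₂⟩ := huniq φ hφK hHφ
  have hc₁0 : c₁ ≠ 0 := by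
    rintro rfl
    exact hψ0 (by rw [hc₁, zero_smul])
  have hφc : φ = (c₂ * c₁⁻¹) • ψ := by
    rw [mul_smul, hc₁, inv_smul_smul₀ hc₁0]
    exact hc₂
  have hsum : ∑ σ, φ σ = ∑ σ, ψ σ :=
    (bijective_comp_equiv (q := 2) (Equiv.addRight a)).sum_comp ψ
  have hs0 : (∑ σ, ψ σ) ≠ 0 := by
    obtain ⟨σ₀, hσ₀⟩ := Function.ne_iff.mp hψ0
    intro h
    have hre : ∑ σ, (ψ σ).re = 0 := by rw [← Complex.re_sum, h, Complex.zero_re]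
    have h0 := (Finset.sum_eq_zero_iff_of_nonneg fun σ _ => (hψnn σ).1).mp hre σ₀ (Finset.mem_univ _)
    exact hσ₀ (Complex.ext (by rw [h0, Pi.zero_apply, Complex.zero_re])
      (by rw [(hψnn σ₀).2, Pi.zero_apply, Complex.zero_im]))
  have hcs : c₂ * c₁⁻¹ * ∑ σ, ψ σ = 1 * ∑ σ, ψ σ := by
    rw [one_mul, Finset.mul_sum, ← hsum]
    refine Finset.sum_congr rfl fun σ _ => ?_
    rw [hφc, Pi.smul_apply, smul_eq_mul]
  have hc : c₂ * c₁⁻¹ = 1 := mul_right_cancel₀ hs0 hcs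
  have h := congrFun hφc σ
  rw [hc, one_smul] at h
  exact h

/-- **One-particle admissible data are flat**: `ψ(1_S) = ψ(1_{{0}})·[|S| = 1]` (sector support +
translation invariance). [folklore] -/
theorem iil_one_flat (L : ℕ) [NeZero L] (hL : 2 ≤ L) (ψ : TensorIndex (TorusSite 3 L) 2 → ℂ)
    (hsec : ψ ∈ spinZSector 1 (((1 : ℕ) : ℝ) - (L : ℝ) ^ 3 / 2)) (hne : ψ ≠ 0)
    (heig : (xyTorus 3 L 1) *ᵥ ψ =
      ((lowestEnergyInSector 1 (xyTorus 3 L 1) (((1 : ℕ) : ℝ) - (L : ℝ) ^ 3 / 2) : ℝ) : ℂ) • ψ)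
    (hnn : ∀ σ, 0 ≤ (ψ σ).re ∧ (ψ σ).im = 0) (S : Finset (TorusSite 3 L)) :
    ψ (fun z => if z ∈ S then 0 else 1) =
      if S.card = 1 then ψ (fun z => if z ∈ ({0} : Finset (TorusSite 3 L)) then 0 else 1) else 0 := by
  have hL3 : 1 ≤ L ^ 3 := Nat.one_le_pow _ _ (Nat.pos_of_ne_zero (NeZero.ne L))
  by_cases hS : S.card = 1
  · obtain ⟨x, rfl⟩ := Finset.card_eq_one.1 hS
    rw [if_pos hS]
    have hti := iil_translationInvariance L hL 1 hL3 ψ hsec hne heig hnn x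
      (fun z => if z ∈ ({x} : Finset (TorusSite 3 L)) then 0 else 1)
    rw [← hti]
    congr 1
    funext z
    simp only [Finset.mem_singleton, add_eq_right]
  · rw [if_neg hS]
    exact iil_apply_ind_eq_zero ψ 1 _ (by rw [iil_card_real]) hsec S hS

/-- **Registered helper stub `stub_insertionInfidelityLowPrelim`** (sub-goal of
`stub_insertionInfidelityLow`, line `Sketch`): admissible sector ground data of `xyTorus 3 L 1` are
translation invariant for every `N ≤ L³` (`iil_translationInvariance`). [folklore] -/
theorem stub_insertionInfidelityLowPrelim :
    ∀ (L : ℕ) [NeZero L], 2 ≤ L → ∀ N : ℕ, N ≤ L ^ 3 →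
      ∀ ψ : TensorIndex (TorusSite 3 L) 2 → ℂ,
        ψ ∈ spinZSector 1 ((N : ℝ) - (L : ℝ) ^ 3 / 2) → ψ ≠ 0 →
        (xyTorus 3 L 1) *ᵥ ψ =
          ((lowestEnergyInSector 1 (xyTorus 3 L 1) ((N : ℝ) - (L : ℝ) ^ 3 / 2) : ℝ) : ℂ) • ψ →
        (∀ σ, 0 ≤ (ψ σ).re ∧ (ψ σ).im = 0) →
        ∀ (a : TorusSite 3 L) (σ : TensorIndex (TorusSite 3 L) 2), ψ (fun x => σ (x + a)) = ψ σ :=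
  fun L _ hL N hN ψ hsec hne heig hnn a σ => iil_translationInvariance L hL N hN ψ hsec hne heig hnn a σ

end Summit.AtomisticToContinuum.BoseEinsteinCondensation.Cruxes.KineticLatticeBEC.SectorLadder

end
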